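import Summits.KontsevichZagierPeriods.KontsevichZagierPeriods.Theorems.FermatIsogenyBetaLinearSectorStubBandNewtonLeibnizEngineAux

/-!
# `BetaLinearSector` (stmt-KontsevichZagierPeriods-3897), line `fermat-sector-transport`:
# GREEN STUB 3 `stub_bandNewtonLeibniz_of_cad_of_subband` — the engine of Green's formula

**Newton–Leibniz down a closed band off a null set, assembled.** For the closed band
`D = {a₀ ≤ x ≤ a₁, α x ≤ y ≤ β x} ⊆ ℝ²` (`α ≤ β` `ℚ`-semialgebraic on `(a₀, a₁)`), a bounded
`ℚ`-semialgebraic `F` on `D`, continuous on the closed fibres and with `∂F/∂y = r.integrand` on the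
open fibres off a `ℚ`-semialgebraic null set `Z`, the representation `r = [D, r.integrand]` differs by
moves of the Kontsevich–Zagier calculus (`KZ.relations`) from the base representation
`r' = [(a₀, a₁), F(x, β x) − F(x, α x)]` — ASSUMING the two registered neighbour stubs as hypotheses:
CAD (a `ℚ`-cylindrical decomposition of the line adapted to the open band `σ₀` and to `Z`) and
SUBBAND (one `newtonLeibnizRel` move per closed sub-band avoiding `Z`).

Proof (template `KZ.of_sub_of_mem_relations_groundLast` / `_cell`, the integrand-`1` case):
0. `r'` exists (`engine_exists_base`).
1. CAD for `σ := σ₀ = {a₀ < x < a₁, α x < y < β x}` (`engine_isSemialgebraic_openBand`), `τ := Z`.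
2. Cut `r` along the cylinders over the cells (`KZ.of_sub_sum_cyl_mem_relations`) and `r'` along the
   cells (`bandNewtonLeibnizEngine_aux_cutPartition`); null cells carry null pieces.
3. Over a cell `C` of positive measure: the `B`-bands are inner (`engine_inner`), `C ⊆ (a₀, a₁)` as
   soon as `B ≠ ∅`, and a `B`-band is disjoint from `Z` because it is not inside the null set `Z`
   (`engine_bandOver_not_subset_null`) — so SUBBAND applies to every `B`-band: `[Bd_j] − [b_j] ∈
   newtonLeibnizRel`. The cylinder piece is `∑_j [Bd_j]` up to null graphs and end fibres
   (`engine_cell_cover`, rule (1)), and `∑_j [b_j] ≡ [C ∩ (a₀, a₁), F(β) − F(α)]` by additivity of the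
   integrand and the fibrewise telescoping `∑_{j ∈ B} (F(ξ_j) − F(ξ_{j-1})) = F(β) − F(α)`
   (`engine_cell_base`, `engine_fibre_telescope`; for `B = ∅` both sides vanish since `α = β` there).
4. Sum over the cells.

References: M. Kontsevich, D. Zagier, *Periods* (2001), §1.2, rules (1), (3); S. Basu, R. Pollack,
M.-F. Roy, *Algorithms in Real Algebraic Geometry* (2006), Cor. 5.7. No definition, no named fact.
-/

noncomputable section

open scoped BigOperators ENNReal
open MeasureTheory Set
open Literature.NumberTheory.Transcendental
open Literature.ModelTheory.ExponentialFields

namespace Summit.KontsevichZagierPeriods.FermatIsogeny.BetaLinearSector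

open Summit.KontsevichZagierPeriods.IsogenyCertificates.GenusTwoRealPeriodCellLine
  (subband_fibreFun_eq subband_isSemialgebraicMapOn_snoc subband_volume_lt_top_of_subset_strip)

/-! ## The base representation `[(a₀, a₁), F(·, β) − F(·, α)]` -/

/-- The target of the engine exists: on the strip `(a₀, a₁) ⊆ ℝ¹` the function
`x ↦ F (x, β x) − F (x, α x)` is `ℚ`-semialgebraic (composition of `F` with the semialgebraic
sections `x ↦ (x, β x)`, `x ↦ (x, α x)` of the closed band), measurable and bounded by `2M`, hence
integrable. [cite: KontsevichZagier2001, §1.2 rule (3)] -/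
theorem engine_exists_base {a₀ a₁ : ℝ} {α β : ℝ → ℝ} (F : (Fin 2 → ℝ) → ℝ) (r : KZ.IntegralRep 2)
    (hdom : r.domain = {p : Fin 2 → ℝ | p 0 ∈ Icc a₀ a₁ ∧ α (p 0) ≤ p 1 ∧ p 1 ≤ β (p 0)})
    (hF : IsSemialgebraicFunOn ℚ r.domain F) (hM : ∃ M : ℝ, ∀ p ∈ r.domain, |F p| ≤ M)
    (hα : IsSemialgebraicFunOn ℚ {z : Fin 1 → ℝ | z 0 ∈ Ioo a₀ a₁} fun z => α (z 0))
    (hβ : IsSemialgebraicFunOn ℚ {z : Fin 1 → ℝ | z 0 ∈ Ioo a₀ a₁} fun z => β (z 0))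
    (hαβ : ∀ t ∈ Ioo a₀ a₁, α t ≤ β t) :
    ∃ r' : KZ.IntegralRep 1, r'.domain = {z : Fin 1 → ℝ | z 0 ∈ Ioo a₀ a₁} ∧
      r'.integrand = fun z => F (Fin.snoc z (β (z 0))) - F (Fin.snoc z (α (z 0))) := by
  obtain ⟨M, hM⟩ := hM
  set S : Set (Fin 1 → ℝ) := {z | z 0 ∈ Ioo a₀ a₁} with hS
  have hSsa : IsSemialgebraic ℚ S := IsSemialgebraicFunOn.isSemialgebraic_holds hα
  have hSm : MeasurableSet S := IsSemialgebraic.measurableSet_holds hSsa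
  have hβmem : ∀ z ∈ S, (Fin.snoc z (β (z 0)) : Fin 2 → ℝ) ∈ r.domain := fun z hz => by
    rw [hdom]
    exact ⟨Ioo_subset_Icc_self hz, hαβ _ hz, le_rfl⟩
  have hαmem : ∀ z ∈ S, (Fin.snoc z (α (z 0)) : Fin 2 → ℝ) ∈ r.domain := fun z hz => by
    rw [hdom]
    exact ⟨Ioo_subset_Icc_self hz, le_rfl, hαβ _ hz⟩
  have hFβ : IsSemialgebraicFunOn ℚ S fun z => F (Fin.snoc z (β (z 0))) :=
    IsSemialgebraicFunOn.comp_isSemialgebraicMapOn_holds hF (subband_isSemialgebraicMapOn_snoc hSsa hβ)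
      hβmem
  have hFα : IsSemialgebraicFunOn ℚ S fun z => F (Fin.snoc z (α (z 0))) :=
    IsSemialgebraicFunOn.comp_isSemialgebraicMapOn_holds hF (subband_isSemialgebraicMapOn_snoc hSsa hα)
      hαmem
  have hg : IsSemialgebraicFunOn ℚ S fun z => F (Fin.snoc z (β (z 0))) - F (Fin.snoc z (α (z 0))) :=
    IsSemialgebraicFunOn.sub_holds hFβ hFα
  have hint : IntegrableOn (fun z => F (Fin.snoc z (β (z 0))) - F (Fin.snoc z (α (z 0)))) S := by
    refine IntegrableOn.of_bound (subband_volume_lt_top_of_subset_strip subset_rfl)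
      (KZ.aestronglyMeasurable_of_isSemialgebraicFunOn hg hSm) (M + M) ?_
    exact (ae_restrict_mem hSm).mono fun z hz => (norm_sub_le _ _).trans
      (add_le_add (by rw [Real.norm_eq_abs]; exact hM _ (hβmem z hz))
        (by rw [Real.norm_eq_abs]; exact hM _ (hαmem z hz)))
  exact ⟨⟨S, _, hSsa, hg, hint⟩, rfl, rfl⟩

/-! ## One cell of positive measure: cutting the cylinder piece into the closed `B`-bands -/

/-- **Rule (1) over one cell.** Over a cell `C` of the base, the piece `r|_{C × ℝ}` of the closed
band differs by relations from the sum of its closed sub-band pieces `Bd_j`, `j ∈ B`: the sub-bands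
cover the piece up to the section graphs, the graphs of `α`, `β` and the two end fibres (all null),
and meet pairwise in graphs. [cite: KontsevichZagier2001, §1.2 rule (1)] -/
theorem engine_cell_cover {a₀ a₁ : ℝ} {α β : ℝ → ℝ}
    (hα : IsSemialgebraicFunOn ℚ {z : Fin 1 → ℝ | z 0 ∈ Ioo a₀ a₁} fun z => α (z 0))
    (hβ : IsSemialgebraicFunOn ℚ {z : Fin 1 → ℝ | z 0 ∈ Ioo a₀ a₁} fun z => β (z 0))
    (r : KZ.IntegralRep 2)
    (hdom : r.domain = {p : Fin 2 → ℝ | p 0 ∈ Icc a₀ a₁ ∧ α (p 0) ≤ p 1 ∧ p 1 ≤ β (p 0)})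
    {C : Set (Fin 1 → ℝ)} {l : ℕ} (ξ : Fin l → (Fin 1 → ℝ) → ℝ)
    (hξ : ∀ i, IsSemialgebraicFunOn ℚ C (ξ i)) (hmono : ∀ x ∈ C, StrictMono fun i => ξ i x)
    (B : Finset (Fin (l + 1))) (hinner : ∀ j ∈ B, j ≠ 0 ∧ j ≠ Fin.last l)
    (hBcov : ∀ x ∈ C, ∀ t : ℝ, x 0 ∈ Ioo a₀ a₁ → α (x 0) < t → t < β (x 0) →
      (∃ j, t = ξ j x) ∨ ∃ j ∈ B, bandLower ξ j x < t ∧ (t : EReal) < bandUpper ξ j x)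
    (Bd : {j // j ∈ B} → KZ.IntegralRep 2)
    (hBdd : ∀ j, (Bd j).domain =
      KZlog.band C (fun x => (bandLower ξ j x).toReal) fun x => (bandUpper ξ j x).toReal)
    (hBdsub : ∀ j, (Bd j).domain ⊆ r.domain) (hBdi : ∀ j, (Bd j).integrand = r.integrand)
    (RC : KZ.IntegralRep 2) (hRCd : RC.domain = r.domain ∩ {z | Fin.init z ∈ C})
    (hRCi : RC.integrand = r.integrand) :
    KZ.of RC - ∑ j ∈ B.attach, KZ.of (Bd j) ∈ KZ.relations := by
  refine KZ.of_sub_sum_of_mem_relations B.attach RC Bd (fun j _ => ?_)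
    (fun j _ z _ => by rw [hBdi, hRCi]) ?_ ?_
  · -- the sub-bands lie in the piece
    rw [Set.sdiff_eq_empty.mpr fun z hz => ?_, measure_empty]
    rw [hRCd]
    refine ⟨hBdsub j hz, ?_⟩
    rw [hBdd] at hz
    exact (KZlog.mem_band.1 hz).1
  · -- the sub-bands cover the piece up to a null set (graphs and the two end fibres)
    have hA : ∀ c : ℝ, volume {z : Fin 2 → ℝ | z 0 = c} = 0 := fun c => by
      rw [volume_pi]
      exact Measure.pi_hyperplane _ _ _
    refine measure_mono_null (fun z hz => ?_)
      (measure_union_null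
        (measure_union_null (measure_iUnion_null fun i => KZ.volume_graph_eq_zero (hξ i))
          (measure_union_null (KZ.volume_graph_eq_zero hα) (KZ.volume_graph_eq_zero hβ)))
        (measure_union_null (hA a₀) (hA a₁)))
    rw [hRCd] at hz
    obtain ⟨⟨hzr, hzC⟩, hzU⟩ := hz
    have hzC : Fin.init z ∈ C := hzC
    rw [hdom] at hzr
    obtain ⟨hz0, hzα, hzβ⟩ := hzr
    rcases hz0.1.eq_or_lt with h0 | h0
    · exact Or.inr (Or.inl h0.symm)
    rcases hz0.2.eq_or_lt with h1 | h1
    · exact Or.inr (Or.inr h1)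
    have hzs : (Fin.init z : Fin 1 → ℝ) ∈ {z : Fin 1 → ℝ | z 0 ∈ Ioo a₀ a₁} := ⟨h0, h1⟩
    rcases hzα.eq_or_lt with h2 | h2
    · exact Or.inl (Or.inr (Or.inl ⟨hzs, h2.symm⟩))
    rcases hzβ.eq_or_lt with h3 | h3
    · exact Or.inl (Or.inr (Or.inr ⟨hzs, h3⟩))
    rcases hBcov (Fin.init z) hzC (z (Fin.last 1)) ⟨h0, h1⟩ h2 h3 with ⟨i, hi⟩ | ⟨j, hjB, hj1, hj2⟩
    · exact Or.inl (Or.inl (mem_iUnion.2 ⟨i, hzC, hi⟩))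
    · refine absurd (mem_iUnion₂.2 ⟨⟨j, hjB⟩, Finset.mem_attach _ _, ?_⟩) hzU
      obtain ⟨hj0, hjl⟩ := hinner j hjB
      rw [hBdd, KZlog.mem_band]
      rw [bandLower_of_ne_zero ξ j hj0, EReal.coe_lt_coe_iff] at hj1
      rw [bandUpper_of_ne_last ξ j hjl, EReal.coe_lt_coe_iff] at hj2
      refine ⟨hzC, ?_, ?_⟩
      · show (bandLower ξ j (Fin.init z)).toReal ≤ z (Fin.last 1)
        rw [bandLower_of_ne_zero ξ j hj0, EReal.toReal_coe]
        exact hj1.le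
      · show z (Fin.last 1) ≤ (bandUpper ξ j (Fin.init z)).toReal
        rw [bandUpper_of_ne_last ξ j hjl, EReal.toReal_coe]
        exact hj2.le
  · -- two distinct sub-bands meet in graphs
    intro j _ j' _ hne
    have hne' : (j : Fin (l + 1)) ≠ j' := fun h => hne (Subtype.ext h)
    obtain ⟨h0, hl⟩ := hinner j j.2
    obtain ⟨h0', hl'⟩ := hinner j' j'.2
    refine measure_mono_null (fun z hz => ?_)
      (measure_union_null
        (measure_union_null (KZ.volume_graph_eq_zero (engine_isSemialgebraicFunOn_lower ξ hξ h0))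
          (KZ.volume_graph_eq_zero (engine_isSemialgebraicFunOn_upper ξ hξ hl)))
        (measure_union_null (KZ.volume_graph_eq_zero (engine_isSemialgebraicFunOn_lower ξ hξ h0'))
          (KZ.volume_graph_eq_zero (engine_isSemialgebraicFunOn_upper ξ hξ hl'))))
    rw [hBdd, hBdd] at hz
    obtain ⟨hz, hz'⟩ := hz
    rcases engine_band_subset ξ h0 hl hz with hb | hg
    · rcases engine_band_subset ξ h0' hl' hz' with hb' | hg'
      · rw [mem_bandOver_iff] at hb hb'
        exact absurd ⟨hb'.2.1, hb'.2.2⟩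
          (Set.disjoint_left.1 (KZ.disjoint_bandFibre ξ (hmono _ hb.1) hne') ⟨hb.2.1, hb.2.2⟩)
      · exact Or.inr hg'
    · exact Or.inl hg

/-! ## One cell: telescoping the base pieces -/

/-- **Rule (1) in the integrand over one cell.** Over a cell `C`, the base piece
`[C ∩ (a₀, a₁), F(·, β) − F(·, α)]` differs by relations from the sum of the base pieces
`[C, F(·, ξ_j) − F(·, ξ_{j-1})]`, `j ∈ B`: if `B ≠ ∅` then `C ⊆ (a₀, a₁)` and the integrands
telescope pointwise (`engine_fibre_telescope`); if `B = ∅` every fibre `(α x, β x)` over `C` consists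
of section values, so `α = β` on `C ∩ (a₀, a₁)` and the base piece has integrand `0`.
[cite: KontsevichZagier2001, §1.2 rule (1)] -/
theorem engine_cell_base {a₀ a₁ : ℝ} {α β : ℝ → ℝ} (hαβ : ∀ t ∈ Ioo a₀ a₁, α t ≤ β t)
    (F : (Fin 2 → ℝ) → ℝ) (r' : KZ.IntegralRep 1) (hr'd : r'.domain = {z : Fin 1 → ℝ | z 0 ∈ Ioo a₀ a₁})
    (hr'i : r'.integrand = fun z => F (Fin.snoc z (β (z 0))) - F (Fin.snoc z (α (z 0))))
    {C : Set (Fin 1 → ℝ)} {l : ℕ} (ξ : Fin l → (Fin 1 → ℝ) → ℝ)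
    (hmono : ∀ x ∈ C, StrictMono fun i => ξ i x) (B : Finset (Fin (l + 1)))
    (hBfib : ∀ j ∈ B, ∀ x ∈ C, ∀ t : ℝ, bandLower ξ j x < t → (t : EReal) < bandUpper ξ j x →
      x 0 ∈ Ioo a₀ a₁ ∧ α (x 0) < t ∧ t < β (x 0))
    (hBcov : ∀ x ∈ C, ∀ t : ℝ, x 0 ∈ Ioo a₀ a₁ → α (x 0) < t → t < β (x 0) →
      (∃ j, t = ξ j x) ∨ ∃ j ∈ B, bandLower ξ j x < t ∧ (t : EReal) < bandUpper ξ j x)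
    (b : {j // j ∈ B} → KZ.IntegralRep 1) (hbd : ∀ j, (b j).domain = C)
    (hbi : ∀ j, (b j).integrand = fun x =>
      F (Fin.snoc x (bandUpper ξ j x).toReal) - F (Fin.snoc x (bandLower ξ j x).toReal))
    (R'C : KZ.IntegralRep 1) (hR'Cd : R'C.domain = r'.domain ∩ C)
    (hR'Ci : R'C.integrand = r'.integrand) :
    KZ.of R'C - ∑ j ∈ B.attach, KZ.of (b j) ∈ KZ.relations := by
  refine KZ.of_sub_sum_integrand_mem_relations B.attach b R'C (fun j _ => ?_) fun x hx => ?_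
  · -- `B ≠ ∅` forces `C ⊆ (a₀, a₁)`
    rw [hbd, hR'Cd, hr'd]
    refine (inter_eq_right.2 fun x hx => ?_).symm
    obtain ⟨t, ht1, ht2⟩ := CylindricalDecomposition.exists_mem_band ξ x (hmono x hx) j
    exact (hBfib j j.2 x hx t ht1 ht2).1
  · rw [hR'Cd, hr'd] at hx
    obtain ⟨hxs, hxC⟩ := hx
    have hxs : x 0 ∈ Ioo a₀ a₁ := hxs
    have hsum : ∑ i ∈ B.attach, (b i).integrand x =
        ∑ j ∈ B, (F (Fin.snoc x (bandUpper ξ j x).toReal) - F (Fin.snoc x (bandLower ξ j x).toReal)) := by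
      simp only [hbi]
      exact Finset.sum_attach B fun j =>
        F (Fin.snoc x (bandUpper ξ j x).toReal) - F (Fin.snoc x (bandLower ξ j x).toReal)
    show R'C.integrand x = ∑ i ∈ B.attach, (b i).integrand x
    rw [hsum, hR'Ci, hr'i]
    exact (engine_fibre_telescope ξ x (hmono x hxC) B (hαβ _ hxs)
      (fun j hj t h1 h2 => (hBfib j hj x hxC t h1 h2).2) (fun t h1 h2 => hBcov x hxC t hxs h1 h2)
      fun s => F (Fin.snoc x s)).symm

/-! ## The stub -/

/-- GREEN STUB 3 (the ENGINE, assembled): Newton–Leibniz down a closed band `{a₀ ≤ x ≤ a₁, α x ≤ y ≤ β x}` off a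
`ℚ`-semialgebraic null set `Z`, from GREEN STUBS 1–2: cut along the cylinders of the adapted decomposition (rule 1a; null
cylinders and section graphs dropped), one sub-band move per `B`-band (stub 2; the `B`-bands avoid `Z` because a band over a
positive-measure cell has positive measure), telescope the base pieces over each cell (rule 1b: the `B`-bands tile `(α x, β x)` up
to the section values, so `Σ_{j∈B} (F(ξ_j) − F(ξ_{j−1})) = F(β) − F(α)` on the cell), and glue the cells of `(a₀, a₁)` (rule 1a).
Template: `KZ.of_sub_of_mem_relations_groundLast` / `_cell`. This IS `stub_bandNewtonLeibniz` of stmt-4990. [cite: KontsevichZagier2001, §1.2 rules (1),(3)] -/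
theorem stub_bandNewtonLeibniz_of_cad_of_subband :
    (∀ {n : ℕ} {σ τ : Set (Fin (n + 1) → ℝ)}, IsSemialgebraic ℚ σ → IsSemialgebraic ℚ τ →
      ∃ (𝒮 : Finset (Set (Fin n → ℝ))) (l : Set (Fin n → ℝ) → ℕ) (ξ : (S : Set (Fin n → ℝ)) → Fin (l S) → (Fin n → ℝ) → ℝ),
        Literature.ModelTheory.ExponentialFields.IsCylindricalDecomposition ℚ n 𝒮 ∧
        (∀ S ∈ 𝒮, ∀ j, IsSemialgebraicFunOn ℚ S (ξ S j)) ∧ (∀ S ∈ 𝒮, ∀ x ∈ S, StrictMono fun j => ξ S j x) ∧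
        (∀ S ∈ 𝒮, ∀ j, Literature.ModelTheory.ExponentialFields.bandOver S (ξ S) j ⊆ τ ∨
          Disjoint (Literature.ModelTheory.ExponentialFields.bandOver S (ξ S) j) τ) ∧
        ∀ S ∈ 𝒮, ∃ B : Finset (Fin (l S + 1)), (∀ j ∈ B, Literature.ModelTheory.ExponentialFields.bandOver S (ξ S) j ⊆ σ) ∧
          ∀ x ∈ S, ∀ t : ℝ, (Fin.snoc x t : Fin (n + 1) → ℝ) ∈ σ → (∃ j, t = ξ S j x) ∨
            ∃ j ∈ B, Literature.ModelTheory.ExponentialFields.bandLower (ξ S) j x < t ∧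
              (t : EReal) < Literature.ModelTheory.ExponentialFields.bandUpper (ξ S) j x) →
    (∀ (a₀ a₁ : ℚ) (α β : ℝ → ℝ) (F : (Fin 2 → ℝ) → ℝ) (Z : Set (Fin 2 → ℝ))
      (r : KZ.IntegralRep 2), r.domain = {p : Fin 2 → ℝ | p 0 ∈ Set.Icc (a₀ : ℝ) a₁ ∧ α (p 0) ≤ p 1 ∧ p 1 ≤ β (p 0)} →
      IsSemialgebraicFunOn ℚ r.domain F → (∃ M : ℝ, ∀ p ∈ r.domain, |F p| ≤ M) →
      (∀ t ∈ Set.Ioo (a₀ : ℝ) a₁, ContinuousOn (fun s : ℝ => F ![t, s]) (Set.Icc (α t) (β t))) →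
      (∀ p ∈ r.domain, p 0 ∈ Set.Ioo (a₀ : ℝ) a₁ → α (p 0) < p 1 → p 1 < β (p 0) → p ∉ Z →
        HasDerivAt (fun s : ℝ => F ![p 0, s]) (r.integrand p) (p 1)) →
      ∀ {C : Set (Fin 1 → ℝ)}, IsSemialgebraic ℚ C → C ⊆ {x | x 0 ∈ Set.Ioo (a₀ : ℝ) a₁} →
      ∀ {lo hi : (Fin 1 → ℝ) → ℝ}, IsSemialgebraicFunOn ℚ C lo → IsSemialgebraicFunOn ℚ C hi → (∀ x ∈ C, lo x < hi x) →
      (∀ x ∈ C, ∀ t ∈ Set.Ioo (lo x) (hi x), (α (x 0) < t ∧ t < β (x 0)) ∧ (Fin.snoc x t : Fin 2 → ℝ) ∉ Z) →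
      ∃ (Bd : KZ.IntegralRep 2) (b : KZ.IntegralRep 1), Bd.domain = KZlog.band C lo hi ∧ Bd.domain ⊆ r.domain ∧
        Bd.integrand = r.integrand ∧ b.domain = C ∧ (b.integrand = fun x => F (Fin.snoc x (hi x)) - F (Fin.snoc x (lo x))) ∧
        KZ.of Bd - KZ.of b ∈ KZ.newtonLeibnizRel) →
    ∀ (a₀ a₁ : ℚ) (α β : ℝ → ℝ) (F : (Fin 2 → ℝ) → ℝ) (Z : Set (Fin 2 → ℝ)) (r : KZ.IntegralRep 2), a₀ < a₁ →
      IsSemialgebraicFunOn ℚ {z : Fin 1 → ℝ | z 0 ∈ Set.Ioo (a₀ : ℝ) a₁} (fun z => α (z 0)) →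
      IsSemialgebraicFunOn ℚ {z : Fin 1 → ℝ | z 0 ∈ Set.Ioo (a₀ : ℝ) a₁} (fun z => β (z 0)) →
      (∀ t ∈ Set.Ioo (a₀ : ℝ) a₁, α t ≤ β t) →
      r.domain = {p : Fin 2 → ℝ | p 0 ∈ Set.Icc (a₀ : ℝ) a₁ ∧ α (p 0) ≤ p 1 ∧ p 1 ≤ β (p 0)} →
      IsSemialgebraicFunOn ℚ r.domain F → (∃ M : ℝ, ∀ p ∈ r.domain, |F p| ≤ M) →
      (∀ t ∈ Set.Ioo (a₀ : ℝ) a₁, ContinuousOn (fun s : ℝ => F ![t, s]) (Set.Icc (α t) (β t))) →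
      IsSemialgebraic ℚ Z → volume Z = 0 →
      (∀ p ∈ r.domain, p 0 ∈ Set.Ioo (a₀ : ℝ) a₁ → α (p 0) < p 1 → p 1 < β (p 0) → p ∉ Z →
        HasDerivAt (fun s : ℝ => F ![p 0, s]) (r.integrand p) (p 1)) →
      ∃ r' : KZ.IntegralRep 1, r'.domain = {z : Fin 1 → ℝ | z 0 ∈ Set.Ioo (a₀ : ℝ) a₁} ∧
        (∀ z ∈ r'.domain, r'.integrand z = F ![z 0, β (z 0)] - F ![z 0, α (z 0)]) ∧
        KZ.of r - KZ.of r' ∈ KZ.relations := by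
  intro hCAD hS a₀ a₁ α β F Z r _ha hα hβ hαβ hdom hF hM hcont hZ hZ0 hder
  classical
  -- Step 0: the base representation
  obtain ⟨r', hr'd, hr'i⟩ := engine_exists_base F r hdom hF hM hα hβ hαβ
  refine ⟨r', hr'd, fun z _ => ?_, ?_⟩
  · rw [hr'i]
    exact congrArg₂ (· - ·) (congrFun (subband_fibreFun_eq F z) (β (z 0)))
      (congrFun (subband_fibreFun_eq F z) (α (z 0)))
  -- Step 1: the adapted cylindrical decomposition of the base line
  obtain ⟨𝒮, l, ξ, hcd, hξ, hmono, hZb, hB⟩ := hCAD (engine_isSemialgebraic_openBand hα hβ) hZ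
  have hpart := hcd.isPartition
  have h𝒮sa := hcd.isSemialgebraic
  -- Step 2: cut `r` along the cylinders and `r'` along the cells (rule (1))
  let R : {C // C ∈ 𝒮} → KZ.IntegralRep 2 := fun C =>
    r.restrict (r.domain ∩ {z | Fin.init z ∈ (C : Set (Fin 1 → ℝ))})
      (r.isSemialgebraic_domain.inter (h𝒮sa C C.2).setOf_init_mem) inter_subset_left
  let R' : {C // C ∈ 𝒮} → KZ.IntegralRep 1 := fun C =>
    r'.restrict (r'.domain ∩ (C : Set (Fin 1 → ℝ))) (r'.isSemialgebraic_domain.inter (h𝒮sa C C.2))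
      inter_subset_left
  have eR : KZ.of r - ∑ C ∈ 𝒮.attach, KZ.of (R C) ∈ KZ.relations :=
    KZ.of_sub_sum_cyl_mem_relations r 𝒮 hpart R (fun C => rfl) fun C x _ => rfl
  have eR' : KZ.of r' - ∑ C ∈ 𝒮.attach, KZ.of (R' C) ∈ KZ.relations :=
    bandNewtonLeibnizEngine_aux_cutPartition r' 𝒮 hpart R' (fun C => rfl) fun C => rfl
  -- Step 3: cell by cell
  have ecell : ∀ C : {C // C ∈ 𝒮}, KZ.of (R C) - KZ.of (R' C) ∈ KZ.relations := by
    intro C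
    obtain ⟨B, hBsub, hBcov⟩ := hB C C.2
    have hCsa : IsSemialgebraic ℚ (C : Set (Fin 1 → ℝ)) := h𝒮sa C C.2
    by_cases hC0 : volume (C : Set (Fin 1 → ℝ)) = 0
    · -- null cells carry null pieces
      refine KZ.relations.sub_mem (KZ.of_mem_relations_of_volume_eq_zero _ ?_)
        (KZ.of_mem_relations_of_volume_eq_zero _ ?_)
      · exact measure_mono_null inter_subset_right (KZ.volume_setOf_init_mem_eq_zero (n := 1) hC0)
      · exact measure_mono_null inter_subset_right hC0
    have hCne : (C : Set (Fin 1 → ℝ)).Nonempty := nonempty_of_measure_ne_zero hC0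
    -- the fibrewise data over the cell
    have hBfib : ∀ j ∈ B, ∀ x ∈ (C : Set (Fin 1 → ℝ)), ∀ t : ℝ, bandLower (ξ C) j x < t →
        (t : EReal) < bandUpper (ξ C) j x → x 0 ∈ Ioo (a₀ : ℝ) a₁ ∧ α (x 0) < t ∧ t < β (x 0) :=
      fun j hj x hx t h1 h2 => hBsub j hj (snoc_mem_bandOver_iff.2 ⟨hx, h1, h2⟩)
    have hBcov' : ∀ x ∈ (C : Set (Fin 1 → ℝ)), ∀ t : ℝ, x 0 ∈ Ioo (a₀ : ℝ) a₁ → α (x 0) < t →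
        t < β (x 0) → (∃ j, t = ξ C j x) ∨
          ∃ j ∈ B, bandLower (ξ C) j x < t ∧ (t : EReal) < bandUpper (ξ C) j x :=
      fun x hx t h0 h1 h2 => hBcov x hx t ⟨h0, h1, h2⟩
    have hinner : ∀ j ∈ B, j ≠ 0 ∧ j ≠ Fin.last (l C) := fun j hj => by
      obtain ⟨x, hx⟩ := hCne
      exact engine_inner (ξ C) x fun t h1 h2 => (hBfib j hj x hx t h1 h2).2
    have hCstrip : ∀ j ∈ B, (C : Set (Fin 1 → ℝ)) ⊆ {x | x 0 ∈ Set.Ioo (a₀ : ℝ) a₁} :=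
      fun j hj x hx => by
        obtain ⟨t, h1, h2⟩ := CylindricalDecomposition.exists_mem_band (ξ C) x (hmono C C.2 x hx) j
        exact (hBfib j hj x hx t h1 h2).1
    have hlt : ∀ j ∈ B, ∀ x ∈ (C : Set (Fin 1 → ℝ)),
        (bandLower (ξ C) j x).toReal < (bandUpper (ξ C) j x).toReal := fun j hj x hx =>
      KZ.toReal_bandLower_lt_toReal_bandUpper (ξ C) (hmono C C.2 x hx) (hinner j hj).1 (hinner j hj).2
    -- the guards of the sub-band move: the `B`-bands lie in the open band and avoid `Z`
    have hguard : ∀ j ∈ B, ∀ x ∈ (C : Set (Fin 1 → ℝ)),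
        ∀ t ∈ Set.Ioo (bandLower (ξ C) j x).toReal (bandUpper (ξ C) j x).toReal,
          (α (x 0) < t ∧ t < β (x 0)) ∧ (Fin.snoc x t : Fin 2 → ℝ) ∉ Z := by
      intro j hj x hx t ht
      rw [← KZ.bandFibre_eq_Ioo (ξ C) (hinner j hj).1 (hinner j hj).2 x] at ht
      obtain ⟨h1, h2⟩ := ht
      refine ⟨(hBfib j hj x hx t h1 h2).2, fun hZ' => ?_⟩
      have hdisj : Disjoint (bandOver (C : Set (Fin 1 → ℝ)) (ξ C) j) Z :=
        (hZb C C.2 j).resolve_left fun hsub => engine_bandOver_not_subset_null hCsa hC0 (ξ C)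
          (hξ C C.2) (hmono C C.2) (hinner j hj).1 (hinner j hj).2 hZ0 hsub
      exact hdisj.ne_of_mem (snoc_mem_bandOver_iff.2 ⟨hx, h1, h2⟩) hZ' rfl
    -- Step 4: one sub-band move per `B`-band (GREEN STUB 2)
    have hBb : ∀ j : {j // j ∈ B}, ∃ (Bd : KZ.IntegralRep 2) (b : KZ.IntegralRep 1),
        Bd.domain = KZlog.band (C : Set (Fin 1 → ℝ)) (fun x => (bandLower (ξ C) j x).toReal)
          (fun x => (bandUpper (ξ C) j x).toReal) ∧
        Bd.domain ⊆ r.domain ∧ Bd.integrand = r.integrand ∧ b.domain = C ∧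
        (b.integrand = fun x => F (Fin.snoc x (bandUpper (ξ C) j x).toReal) -
          F (Fin.snoc x (bandLower (ξ C) j x).toReal)) ∧
        KZ.of Bd - KZ.of b ∈ KZ.newtonLeibnizRel := fun j =>
      hS a₀ a₁ α β F Z r hdom hF hM hcont hder hCsa (hCstrip j j.2)
        (engine_isSemialgebraicFunOn_lower (ξ C) (hξ C C.2) (hinner j j.2).1)
        (engine_isSemialgebraicFunOn_upper (ξ C) (hξ C C.2) (hinner j j.2).2) (hlt j j.2) (hguard j j.2)
    choose Bd b hBdd hBdsub hBdi hbd hbi hNL using hBb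
    -- Step 5: assemble the cell
    have e1 : KZ.of (R C) - ∑ j ∈ B.attach, KZ.of (Bd j) ∈ KZ.relations :=
      engine_cell_cover hα hβ r hdom (ξ C) (hξ C C.2) (hmono C C.2) B hinner hBcov' Bd hBdd hBdsub hBdi
        (R C) rfl rfl
    have eNL : ∑ j ∈ B.attach, KZ.of (Bd j) - ∑ j ∈ B.attach, KZ.of (b j) ∈ KZ.relations :=
      KZ.sum_sub_sum_mem_relations _ _ _ fun j _ => KZ.newtonLeibnizRel_subset_relations (hNL j)
    have e3 : KZ.of (R' C) - ∑ j ∈ B.attach, KZ.of (b j) ∈ KZ.relations :=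
      engine_cell_base hαβ F r' hr'd hr'i (ξ C) (hmono C C.2) B hBfib hBcov' b hbd hbi (R' C) rfl rfl
    have : KZ.of (R C) - KZ.of (R' C) = (KZ.of (R C) - ∑ j ∈ B.attach, KZ.of (Bd j)) +
        (∑ j ∈ B.attach, KZ.of (Bd j) - ∑ j ∈ B.attach, KZ.of (b j)) -
        (KZ.of (R' C) - ∑ j ∈ B.attach, KZ.of (b j)) := by abel
    rw [this]
    exact KZ.relations.sub_mem (KZ.relations.add_mem e1 eNL) e3
  -- Step 6: glue the cells
  have esum : ∑ C ∈ 𝒮.attach, KZ.of (R C) - ∑ C ∈ 𝒮.attach, KZ.of (R' C) ∈ KZ.relations :=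
    KZ.sum_sub_sum_mem_relations _ _ _ fun C _ => ecell C
  have : KZ.of r - KZ.of r' = (KZ.of r - ∑ C ∈ 𝒮.attach, KZ.of (R C)) +
      (∑ C ∈ 𝒮.attach, KZ.of (R C) - ∑ C ∈ 𝒮.attach, KZ.of (R' C)) -
      (KZ.of r' - ∑ C ∈ 𝒮.attach, KZ.of (R' C)) := by abel
  rw [this]
  exact KZ.relations.sub_mem (KZ.relations.add_mem eR esum) eR'

end Summit.KontsevichZagierPeriods.FermatIsogeny.BetaLinearSector

end
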